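import Mathlib
import Summits.Ventures.PercRepro.PuncturedLYMUnif67Table

/-!
# PercRepro — (SP) FOR ANY NUMBER OF PAIRWISE DISJOINT `6`-SETS AT LEVEL `7`: THE COLUMN IDENTITIES (7)
(p10, gen 41)

For each free column class `(d1, …, d5)` (`Σ v d_v ≤ 8`): the `v d_v` rows obtained by removing a point of a member met in `v`
points (class `d − e_v + e_{v−1}`, direction `v − 1`) and the `8 − Σ v d_v` rows obtained by removing a free point (class `d`,
direction `6`) carry total weight `1`.  The member columns carry `6 · (1/6) = 1`.  Nothing here asserts (SP).
-/

namespace PercRepro.PuncturedLYM.Split.TypeLift.Unif67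

set_option maxHeartbeats 4000000 in
set_option maxRecDepth 20000 in
/-- The column identity of the free column class `(3, 1, 1, 0, 0)`. -/
theorem col_31100 (n k : ℚ) (hQ : Qp n k ≠ 0) (hP : Pp n k ≠ 0) :
    1 * 3 * raw n k 2 1 1 0 0 0 + 2 * 1 * raw n k 4 0 1 0 0 1 + 3 * 1 * raw n k 3 2 0 0 0 2 = 1 := by
  simp (config := {decide := true}) only [raw, sel, sel_21100, sel_32000, sel_40100, if_true, if_false]
  field_simp
  unfold Qp Pp N_21100_D0 N_40100_D1 N_32000_D2
  ring

set_option maxHeartbeats 4000000 in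
set_option maxRecDepth 20000 in
/-- The column identity of the free column class `(4, 0, 0, 1, 0)`. -/
theorem col_40010 (n k : ℚ) (hQ : Qp n k ≠ 0) (hP : Pp n k ≠ 0) :
    1 * 4 * raw n k 3 0 0 1 0 0 + 4 * 1 * raw n k 4 0 1 0 0 3 = 1 := by
  simp (config := {decide := true}) only [raw, sel, sel_30010, sel_40100, if_true, if_false]
  field_simp
  unfold Qp Pp N_30010_D0 N_40100_D3
  ring

set_option maxHeartbeats 4000000 in
set_option maxRecDepth 20000 in
/-- The column identity of the free column class `(4, 2, 0, 0, 0)`. -/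
theorem col_42000 (n k : ℚ) (hQ : Qp n k ≠ 0) (hP : Pp n k ≠ 0) :
    1 * 4 * raw n k 3 2 0 0 0 0 + 2 * 2 * raw n k 5 1 0 0 0 1 = 1 := by
  simp (config := {decide := true}) only [raw, sel, sel_32000, sel_51000, if_true, if_false]
  field_simp
  unfold Qp Pp N_32000_D0 N_51000_D1
  ring

set_option maxHeartbeats 4000000 in
set_option maxRecDepth 20000 in
/-- The column identity of the free column class `(5, 0, 1, 0, 0)`. -/
theorem col_50100 (n k : ℚ) (hQ : Qp n k ≠ 0) (hP : Pp n k ≠ 0) :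
    1 * 5 * raw n k 4 0 1 0 0 0 + 3 * 1 * raw n k 5 1 0 0 0 2 = 1 := by
  simp (config := {decide := true}) only [raw, sel, sel_40100, sel_51000, if_true, if_false]
  field_simp
  unfold Qp Pp N_40100_D0 N_51000_D2
  ring

set_option maxHeartbeats 4000000 in
set_option maxRecDepth 20000 in
/-- The column identity of the free column class `(6, 1, 0, 0, 0)`. -/
theorem col_61000 (n k : ℚ) (hQ : Qp n k ≠ 0) (hP : Pp n k ≠ 0) :
    1 * 6 * raw n k 5 1 0 0 0 0 + 2 * 1 * raw n k 7 0 0 0 0 1 = 1 := by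
  simp (config := {decide := true}) only [raw, sel, sel_51000, sel_70000, if_true, if_false]
  field_simp
  unfold Qp Pp N_51000_D0 N_70000_D1
  ring

set_option maxHeartbeats 4000000 in
set_option maxRecDepth 20000 in
/-- The column identity of the free column class `(8, 0, 0, 0, 0)`. -/
theorem col_80000 (n k : ℚ) (hQ : Qp n k ≠ 0) (hP : Pp n k ≠ 0) :
    1 * 8 * raw n k 7 0 0 0 0 0 = 1 := by
  simp (config := {decide := true}) only [raw, sel, sel_70000, if_true, if_false]
  field_simp
  unfold Qp Pp N_70000_D0
  ring

end PercRepro.PuncturedLYM.Split.TypeLift.Unif67
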